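import Literature.AlgebraicGeometry.Resolution.BlowupStalkBlowupAlgebra
import Literature.AlgebraicGeometry.Resolution.LipmanValuativeQuadraticSequenceProofs
import HarnessLib

/-!
# [OURS · L1 W4.5(b) · EL♮] Every prime OVER `𝔪_s` of a stalk blow-up chart `𝒪_{X,s}[J_s/c_j]` is the local ring of a point of the
# blowing up over `s` — the converse direction of the tree's dictionary `IsBlowup.exists_blowupAlgebra_stalk_ringEquiv`
# (crux `EquisingularLiftNat` = stmt-ResolutionOfSingularities-20038; K-∀n / K5-BMY lane, kill test #50)

HONEST FRAMING. OURS (cell res-hironaka, crux chain w45b, slot W4.5(b)); NOT a statement of any manuscript; replaces the role of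
NOTHING in the manuscript; AI-written, AI review is weaker than expert review. Helper `--supports stmt-ResolutionOfSingularities-20038
--as helper`. Purpose: to read the RING-LEVEL chart statements of this lane (K-RIBBON `RibbonTouch.exists_prime_not_isRegularLocalRing`
p541471: a prime over `𝔪_A` of `A[(ū₁,ū₂)/ū₁]` with non-regular localisation; K-COMP-LOCAL / K-VERTEX-EXIT: regular chart algebras) at
the POINTS of an actual blowing up `π : X′ → X` (`IsBlowup π J`, universal property). The tree's `BlowupStalkCharts` /
`BlowupStalkBlowupAlgebra` go from a point `x′` to a prime of some chart; here the other way: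

* input: the tree's `IsBlowup.exists_chart_morphism_of_index` (`…LipmanValuativeQuadraticSequenceProofs`) — for EVERY index `j`, a
  morphism `q : Spec (𝒪_{X,s}[J_s t])_{(c_j t)} → X′` inducing isomorphisms on all local rings and lying over `Spec 𝒪_{X,s} → X`;
* `exists_point_isRegularLocalRing_iff_of_reesChart_prime` — a prime `𝔴` of the Rees chart ring lying over `𝔪_s` is hit: some
  `x′ ∈ X′` with `π x′ = s` and `𝒪_{X′,x′} ≅ (chart ring)_𝔴` (so `x′` is regular iff `𝔴` is);
* `exists_point_isRegularLocalRing_iff_of_blowupAlgebra_prime` — the same for a prime `𝔓` of the affine blow-up algebra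
  `𝒪_{X,s}[J_s/c_j]` (image model, `blowupAlgebra`) over `𝔪_s`: some `x′` over `s` with `𝒪_{X′,x′} ≅ (𝒪_{X,s}[J_s/c_j])_𝔓`;
* `exists_point_not_isRegularLocalRing_of_chart` — COROLLARY: a non-regular prime over `𝔪_s` on some chart ⇒ a NON-REGULAR
  point of `X′` over `s` (how K-RIBBON is consumed: the blow-up of the strict transform along the ribbon trace is not regular over `x_j`).

References: tree `Literature…BlowupStalkCharts` (`exists_stalk_ringHom_of_chart`, `comap_fromSpecStalk_eq_affineBlowupIdealSheaf`),
`…BlowupStalkBlowupAlgebra` (`blowupAlgebra_stalk_ringEquiv_of_reesChart`), `…BlowupsFlatBaseChange` (`isIso_stalkMap_pullback_fst_fromSpecStalk`),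
`…AffineBlowupCartier` (`affineBlowup.chartι`); [StacksProject, Tag 0804]; [Temkin2008, §2.1].
-/

set_option linter.dupNamespace false -- mandated namespace `Summit.<Summit>.<Problem>` of this single-conjunct summit

noncomputable section

universe u

open CategoryTheory CategoryTheory.Limits AlgebraicGeometry TopologicalSpace IsLocalRing
open Literature.AlgebraicGeometry.Resolution
open AlgebraicGeometry.Scheme.IdealSheafData

namespace Summit.ResolutionOfSingularities.ResolutionOfSingularities.Cruxes.EquisingularLiftNat.Sections

namespace ChartPoint

variable {X' X : Scheme.{u}} {π : X' ⟶ X} {J : X.IdealSheafData}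

/-- A point of `Spec B` lying over the maximal ideal of the local ring `𝒪_{X,s}` maps to `s` under `Spec B → Spec 𝒪_{X,s} → X`.
[folklore] -/
theorem fromSpecStalk_Spec_map_apply_eq {B : CommRingCat.{u}} (s : X) (φ : X.presheaf.stalk s →+* B) (w : Spec B)
    (hw : w.asIdeal.comap φ = maximalIdeal (X.presheaf.stalk s)) :
    (Spec.map (CommRingCat.ofHom φ) ≫ X.fromSpecStalk s) w = s := by
  rw [Scheme.Hom.comp_apply]
  have h : (Spec.map (CommRingCat.ofHom φ)) w = closedPoint (X.presheaf.stalk s) := by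
    apply PrimeSpectrum.ext
    change Ideal.comap _ w.asIdeal = maximalIdeal _
    exact hw
  rw [h]
  exact Scheme.fromSpecStalk_closedPoint

/-- **Every prime over `𝔪_s` of a Rees chart is a point of the blow-up over `s`**, with isomorphic local rings: for a blowing up `π`
along `J`, generators `c` of `J_s`, an index `j` and a prime `𝔴` of `(𝒪_{X,s}[J_s t])_{(c_j t)}` lying over `𝔪_s`, some `x′ ∈ X′` has
`π x′ = s` and `𝒪_{X′,x′} ≅ (chart ring)_𝔴`; in particular `𝒪_{X′,x′}` is regular iff the localisation at `𝔴` is. [cite: StacksProject, Tag 0804] -/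
theorem exists_point_isRegularLocalRing_iff_of_reesChart_prime (hπ : IsBlowup π J) (s : X) {k : ℕ} (c : Fin k → X.presheaf.stalk s)
    (hc : Ideal.span (Set.range c) = stalkIdeal J s) (j : Fin k) (w : Spec (.of (chartRing c j)))
    (hw : w.asIdeal.comap (chartBase c j) = maximalIdeal (X.presheaf.stalk s)) :
    ∃ x' : X', π x' = s ∧ Nonempty (X'.presheaf.stalk x' ≃+* Localization.AtPrime w.asIdeal) ∧
      (IsRegularLocalRing (X'.presheaf.stalk x') ↔ IsRegularLocalRing (Localization.AtPrime w.asIdeal)) := by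
  obtain ⟨q, hiso, hsq⟩ := IsBlowup.exists_chart_morphism_of_index hπ s c hc j
  have hx : π (q w) = s := by
    have h1 : (q ≫ π) w = π (q w) := Scheme.Hom.comp_apply q π w
    rw [← h1, hsq]
    exact fromSpecStalk_Spec_map_apply_eq (B := CommRingCat.of (chartRing c j)) s (chartBase c j) w hw
  haveI := hiso w
  let e₁ : X'.presheaf.stalk (q w) ≃+* (Spec (CommRingCat.of (chartRing c j))).presheaf.stalk w :=
    (asIso (q.stalkMap w)).commRingCatIsoToRingEquiv
  let e₂ : (Spec (CommRingCat.of (chartRing c j))).presheaf.stalk w ≃+* Localization.AtPrime w.asIdeal :=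
    (Spec.stalkIso (.of (chartRing c j)) w).commRingCatIsoToRingEquiv
  refine ⟨q w, hx, ⟨e₁.trans e₂⟩, ?_, ?_⟩
  · intro h
    exact IsRegularLocalRing.of_ringEquiv (e₁.trans e₂)
  · intro h
    exact IsRegularLocalRing.of_ringEquiv (e₁.trans e₂).symm

/-- **Every prime over `𝔪_s` of an affine blow-up algebra chart `𝒪_{X,s}[J_s/c_j]` (image model, `blowupAlgebra`) is a point of the
blow-up over `s`**, with `𝒪_{X′,x′} ≅ (𝒪_{X,s}[J_s/c_j])_𝔓`; in particular regularity of `x′` is read on `𝔓` (transport along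
`reesChartEquiv`, Stacks 07Z3). [cite: StacksProject, Tags 0804, 07Z3] -/
theorem exists_point_isRegularLocalRing_iff_of_blowupAlgebra_prime (hπ : IsBlowup π J) (s : X) {k : ℕ}
    (c : Fin k → X.presheaf.stalk s) (hc : Ideal.span (Set.range c) = stalkIdeal J s) (j : Fin k)
    (𝔓 : PrimeSpectrum (blowupAlgebra (Ideal.span (Set.range c)) (c j)))
    (h𝔓 : 𝔓.asIdeal.comap (algebraMap _ (blowupAlgebra (Ideal.span (Set.range c)) (c j))) = maximalIdeal (X.presheaf.stalk s)) :
    ∃ x' : X', π x' = s ∧ Nonempty (X'.presheaf.stalk x' ≃+* Localization.AtPrime 𝔓.asIdeal) ∧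
      (IsRegularLocalRing (X'.presheaf.stalk x') ↔ IsRegularLocalRing (Localization.AtPrime 𝔓.asIdeal)) := by
  let ε : (CommRingCat.of (chartRing c j) : Type u) ≃+* blowupAlgebra (Ideal.span (Set.range c)) (c j) :=
    reesChartEquiv (I := Ideal.span (Set.range c)) (c j) (Ideal.mem_span_range_self (f := c) (x := j))
  have hε : ∀ a, ε (chartBase c j a) = algebraMap _ (blowupAlgebra (Ideal.span (Set.range c)) (c j)) a :=
    reesChartEquiv_reesChartBase (c j) _
  -- the corresponding prime `𝔴 = ε⁻¹ 𝔓` of the Rees chart, again over `𝔪_s`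
  let w : Spec (.of (chartRing c j)) := ⟨𝔓.asIdeal.comap ε.toRingHom, by infer_instance⟩
  have hwmem : ∀ b, b ∈ w.asIdeal ↔ ε b ∈ 𝔓.asIdeal := fun b => Iff.rfl
  have hwmem' : ∀ a, chartBase c j a ∈ w.asIdeal ↔
      algebraMap _ (blowupAlgebra (Ideal.span (Set.range c)) (c j)) a ∈ 𝔓.asIdeal := fun a => by
    rw [hwmem, hε]
  have hw : w.asIdeal.comap (chartBase c j) = maximalIdeal (X.presheaf.stalk s) := by
    ext a
    rw [Ideal.mem_comap, hwmem', ← h𝔓, Ideal.mem_comap]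
  obtain ⟨x', hx, ⟨e⟩, -⟩ := exists_point_isRegularLocalRing_iff_of_reesChart_prime hπ s c hc j w hw
  -- `ε` maps the complement of `𝔴` onto the complement of `𝔓`
  have H : Submonoid.map (RingEquiv.toMonoidHom ε) w.asIdeal.primeCompl = 𝔓.asIdeal.primeCompl := by
    ext b
    constructor
    · rintro ⟨a, ha, rfl⟩
      exact fun hb => ha ((hwmem a).mpr hb)
    · intro hb
      refine ⟨ε.symm b, fun ha => hb ?_, ε.apply_symm_apply b⟩
      have := (hwmem _).mp ha
      rwa [RingEquiv.apply_symm_apply] at this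
  have e₃ : Localization.AtPrime w.asIdeal ≃+* Localization.AtPrime 𝔓.asIdeal :=
    IsLocalization.ringEquivOfRingEquiv (M := w.asIdeal.primeCompl) (T := 𝔓.asIdeal.primeCompl)
      (Localization.AtPrime w.asIdeal) (Localization.AtPrime 𝔓.asIdeal) (h := ε) H
  refine ⟨x', hx, ⟨e.trans e₃⟩, ?_, ?_⟩
  · intro h
    exact @IsRegularLocalRing.of_ringEquiv _ _ h _ _ (e.trans e₃)
  · intro h
    exact @IsRegularLocalRing.of_ringEquiv _ _ h _ _ (e.trans e₃).symm

/-- **COROLLARY (how K-RIBBON is consumed): a non-regular chart prime over `𝔪_s` gives a NON-REGULAR point of the blow-up over `s`.**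
For a blowing up `π : X′ → X` along `J`, generators `c` of `J_s`, and a prime `𝔓` of `𝒪_{X,s}[J_s/c_j]` over `𝔪_s` (as an ideal) with
non-regular localisation: some `x′ ∈ X′` over `s` has a non-regular local ring. OURS. -/
theorem exists_point_not_isRegularLocalRing_of_chart (hπ : IsBlowup π J) (s : X) {k : ℕ} (c : Fin k → X.presheaf.stalk s)
    (hc : Ideal.span (Set.range c) = stalkIdeal J s) (j : Fin k) (𝔓 : Ideal (blowupAlgebra (Ideal.span (Set.range c)) (c j)))
    [𝔓.IsPrime] (h𝔓 : 𝔓.comap (algebraMap _ (blowupAlgebra (Ideal.span (Set.range c)) (c j))) = maximalIdeal (X.presheaf.stalk s))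
    (hnr : ¬ IsRegularLocalRing (Localization.AtPrime 𝔓)) :
    ∃ x' : X', π x' = s ∧ ¬ IsRegularLocalRing (X'.presheaf.stalk x') := by
  obtain ⟨x', hx, -, hiff⟩ := exists_point_isRegularLocalRing_iff_of_blowupAlgebra_prime hπ s c hc j ⟨𝔓, inferInstance⟩ h𝔓
  exact ⟨x', hx, fun h => hnr (hiff.mp h)⟩

end ChartPoint

end Summit.ResolutionOfSingularities.ResolutionOfSingularities.Cruxes.EquisingularLiftNat.Sections
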